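import Literature.MathematicalPhysics.KineticTheory.ReyBelletThomas2002Proofs
import Literature.Probability.Process.HarrisSemigroup
import Literature.Probability.Process.KrylovBogoliubov
import HarnessLib

/-!
# Rey-Bellet–Thomas 2002, §5: the ergodic conclusions of Theorem 2.1 from the analytic inputs (26), (39) and small compact sets

Topic `Literature/MathematicalPhysics/KineticTheory` (trunk T-KINETIC). Provefact unit for the
named fact `ReyBelletThomas2002_thm21` (`ReyBelletThomas2002.lean`). This file PROVES the
measure-theoretic assembly of §5 of Rey-Bellet–Thomas 2002 ("Proof of Theorem 2.1") for a GIVEN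
Markov semigroup `S : MarkovSemigroupFor (P.rbGenerator Λ N T_L T_R)` with generator `L` (13),
from the three analytic inputs of the printed proof, taken as explicit hypotheses in their printed
form (no named fact is introduced):

* (26) (Lemma 3.5, "no-runaway"): `T^t e^{θG}(x) ≤ e^{γ Tr(T) θ t} e^{θG(x)}` for `0 < θ < θ₀`,
  `θ₀ = (max{T_1,T_n})⁻¹` — hypothesis `h26`;
* (39) (Theorem 3.10): for some `s > 0`, `T^s e^{θG} ≤ κ e^{θG} + L 1_U` with `κ < 1`, `U`
  compact — hypothesis `h39` (printed for every `s > 0`; one `s` suffices);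
* "every compact set is small for all large times" for the kernels of `S` (the Meyn–Tweedie
  input behind Theorem 5.1, obtained in RBT from §4: strong Feller property = smooth densities,
  Prop. 4.1 + Hörmander, and strong aperiodicity `P_t(x, A) > 0`, Prop. 4.2; abstractly
  `Literature.Probability.Process.MarkovSemigroup.exists_smul_restrict_le_of_isCompact`) —
  hypothesis `hsmall`;

together with the Feller property of `S` and compactness of the sublevel sets `{G ≤ E}` (H1).
Conclusions (`ReyBelletThomas2002_thm21_ergodic_of_inputs`): `S` has exactly one invariant
probability measure `μ` (existence: Krylov–Bogoliubov, `KrylovBogoliubov.lean`; uniqueness: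
Harris on a skeleton, `HarrisSemigroup.lean`), `e^{θG} ∈ L¹(μ)` and `∈ L¹(P_t(x,·))`, the
exponential convergence (16) `|T^t f(x) - μ(f)| ≤ R r^{-t} e^{θG(x)}` for measurable `|f| ≤ e^{θG}`,
and the exponential decay of correlations of Theorem 2.1 (Cor. 5.2's argument: (16) at level `θ/2`
and `μ(e^{θG}) < ∞`) — i.e. literally the last block of the vendored statement
`ReyBelletThomas2002_thm21`, for `S`.

## References

* L. Rey-Bellet, L. E. Thomas, Comm. Math. Phys. **225** (2002) 305–329 (arXiv:math-ph/0110024):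
  Lemma 3.5, Thm 3.10, §5 (Thm 5.1, proof of Thm 2.1, Cor. 5.2).
* M. Hairer, J. C. Mattingly, Progr. Probab. 63 (2011) 109–117 (Harris' theorem).
-/

noncomputable section

open MeasureTheory ProbabilityTheory Filter Set Literature.Probability.Process
open scoped NNReal ENNReal Topology BoundedContinuousFunction

namespace Literature.MathematicalPhysics.KineticTheory.HeatConduction

variable {N : ℕ}

namespace OscillatorChain

variable (P : OscillatorChain)

/-- The Lyapunov function `e^{θG}` is continuous (continuous potentials). [folklore] -/
theorem continuous_exp_mul_rbEnergy (hU : Continuous P.U) (hV : Continuous P.V) (N : ℕ) (θ : ℝ) :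
    Continuous fun x : RBPhaseSpace N => Real.exp (θ * P.rbEnergy N x) :=
  Real.continuous_exp.comp (continuous_const.mul (P.continuous_rbEnergy hU hV N))

/-- If the sublevel sets of `G` are compact then so are those of `e^{θG}`, `θ > 0`. [folklore] -/
theorem isCompact_setOf_exp_rbEnergy_le (hU : Continuous P.U) (hV : Continuous P.V)
    (hcpt : ∀ E : ℝ, IsCompact {x : RBPhaseSpace N | P.rbEnergy N x ≤ E}) {θ : ℝ} (hθ : 0 < θ)
    (R : ℝ≥0) :
    IsCompact {x : RBPhaseSpace N | (Real.exp (θ * P.rbEnergy N x)).toNNReal ≤ R} := by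
  have hcont : Continuous fun x : RBPhaseSpace N => (Real.exp (θ * P.rbEnergy N x)).toNNReal :=
    continuous_real_toNNReal.comp (P.continuous_exp_mul_rbEnergy hU hV N θ)
  refine (hcpt (Real.log (max (R : ℝ) 1) / θ)).of_isClosed_subset
    (isClosed_le hcont continuous_const) ?_
  intro x hx
  rw [mem_setOf_eq, Real.toNNReal_le_iff_le_coe] at hx
  rw [mem_setOf_eq, le_div_iff₀ hθ, mul_comm, Real.le_log_iff_exp_le (by positivity)]
  exact hx.trans (le_max_left _ _)

/-- A continuous `G` with compact sublevel sets is bounded below. [folklore] -/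
theorem exists_le_rbEnergy (hU : Continuous P.U) (hV : Continuous P.V)
    (hcpt : ∀ E : ℝ, IsCompact {x : RBPhaseSpace N | P.rbEnergy N x ≤ E}) :
    ∃ m₀ : ℝ, ∀ x : RBPhaseSpace N, m₀ ≤ P.rbEnergy N x := by
  have hc := P.continuous_rbEnergy hU hV N
  obtain ⟨x₁, hx₁, hmin⟩ := (hcpt (P.rbEnergy N 0)).exists_isMinOn
    ⟨(0 : RBPhaseSpace N), show P.rbEnergy N 0 ≤ P.rbEnergy N 0 from le_rfl⟩ hc.continuousOn
  refine ⟨P.rbEnergy N x₁, fun x => ?_⟩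
  by_cases hx : P.rbEnergy N x ≤ P.rbEnergy N 0
  · exact hmin hx
  · exact (show P.rbEnergy N x₁ ≤ P.rbEnergy N 0 from hx₁).trans (le_of_lt (not_le.1 hx))

end OscillatorChain

/-! ### The assembly -/

section Assembly

variable {P : OscillatorChain} {Λ : ℝ} {T_L T_R : ℝ} (hUc : Continuous P.U) (hVc : Continuous P.V)
  (hγ : 0 ≤ P.γ) (hL : 0 < T_L) (hR : 0 < T_R)
  (hcpt : ∀ E : ℝ, IsCompact {x : RBPhaseSpace N | P.rbEnergy N x ≤ E})
  (S : MarkovSemigroupFor (P.rbGenerator Λ N T_L T_R))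
  (hFeller : ∀ (t : ℝ≥0) (g : RBPhaseSpace N →ᵇ ℝ), Continuous (S.act t g))
  (h26 : ∀ θ : ℝ, 0 < θ → θ < 1 / max T_L T_R → ∀ (t : ℝ≥0) (x : RBPhaseSpace N),
    ∫⁻ y, ENNReal.ofReal (Real.exp (θ * P.rbEnergy N y)) ∂(S.kernel t x) ≤
      ENNReal.ofReal (Real.exp (P.γ * (T_L + T_R) * θ * t) * Real.exp (θ * P.rbEnergy N x)))
  (h39 : ∀ θ : ℝ, 0 < θ → θ < 1 / max T_L T_R →
    ∃ (s : ℝ≥0) (κ L : ℝ) (U : Set (RBPhaseSpace N)), 0 < s ∧ 0 < κ ∧ κ < 1 ∧ 0 ≤ L ∧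
      IsCompact U ∧ ∀ x,
        ∫⁻ y, ENNReal.ofReal (Real.exp (θ * P.rbEnergy N y)) ∂(S.kernel s x) ≤
          ENNReal.ofReal (κ * Real.exp (θ * P.rbEnergy N x) + L * U.indicator 1 x))
  (hsmall : ∀ C : Set (RBPhaseSpace N), IsCompact C → ∃ t_C : ℝ≥0, ∀ t : ℝ≥0, t_C ≤ t →
    ∃ ν : Measure (RBPhaseSpace N), ν ≠ 0 ∧ ∀ z ∈ C, ν ≤ S.kernel t z)

include hUc hVc in
/-- The printed drift (39) and small compact sets, in the form consumed by
`HarrisSemigroup.lean` for `V = e^{θG}`: a geometric drift at one time and a minorisation on the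
sublevel sets of `V`. [cite: ReyBelletThomas2002, Thm 3.10] -/
theorem harris_inputs_of_h39 (hcpt : ∀ E : ℝ, IsCompact {x : RBPhaseSpace N | P.rbEnergy N x ≤ E})
    (h39 : ∀ θ : ℝ, 0 < θ → θ < 1 / max T_L T_R →
      ∃ (s : ℝ≥0) (κ L : ℝ) (U : Set (RBPhaseSpace N)), 0 < s ∧ 0 < κ ∧ κ < 1 ∧ 0 ≤ L ∧
        IsCompact U ∧ ∀ x,
          ∫⁻ y, ENNReal.ofReal (Real.exp (θ * P.rbEnergy N y)) ∂(S.kernel s x) ≤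
            ENNReal.ofReal (κ * Real.exp (θ * P.rbEnergy N x) + L * U.indicator 1 x))
    (hsmall : ∀ C : Set (RBPhaseSpace N), IsCompact C → ∃ t_C : ℝ≥0, ∀ t : ℝ≥0, t_C ≤ t →
      ∃ ν : Measure (RBPhaseSpace N), ν ≠ 0 ∧ ∀ z ∈ C, ν ≤ S.kernel t z)
    {θ : ℝ} (hθ0 : 0 < θ) (hθ1 : θ < 1 / max T_L T_R) :
    ∃ (t₁ : ℝ≥0) (a b₀ : ℝ≥0), 0 < t₁ ∧ a < 1 ∧
      (∀ z, ∫⁻ y, ((Real.exp (θ * P.rbEnergy N y)).toNNReal : ℝ≥0∞) ∂(S.kernel t₁ z) ≤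
        (a : ℝ≥0∞) * (Real.exp (θ * P.rbEnergy N z)).toNNReal + b₀) ∧
      (∀ R : ℝ≥0, ∃ t_R : ℝ≥0, ∀ t : ℝ≥0, t_R ≤ t → ∃ ν : Measure (RBPhaseSpace N), ν ≠ 0 ∧
        ∀ z, (Real.exp (θ * P.rbEnergy N z)).toNNReal ≤ R → ν ≤ S.kernel t z) := by
  obtain ⟨s, κ₀, L, U, hs, hκ0, hκ1, hL0, -, hbound⟩ := h39 θ hθ0 hθ1
  have hVcoe : ∀ z : RBPhaseSpace N, (((Real.exp (θ * P.rbEnergy N z)).toNNReal : ℝ≥0) : ℝ≥0∞) =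
      ENNReal.ofReal (Real.exp (θ * P.rbEnergy N z)) := fun z => rfl
  refine ⟨s, κ₀.toNNReal, L.toNNReal, hs, ?_, fun z => ?_, fun R => ?_⟩
  · rw [← NNReal.coe_lt_coe, Real.coe_toNNReal _ hκ0.le, NNReal.coe_one]; exact hκ1
  · simp only [hVcoe]
    refine (hbound z).trans ?_
    calc ENNReal.ofReal (κ₀ * Real.exp (θ * P.rbEnergy N z) + L * U.indicator 1 z)
        ≤ ENNReal.ofReal (κ₀ * Real.exp (θ * P.rbEnergy N z)) + ENNReal.ofReal (L * U.indicator 1 z) :=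
          ENNReal.ofReal_add_le
      _ ≤ ENNReal.ofReal (κ₀ * Real.exp (θ * P.rbEnergy N z)) + ENNReal.ofReal L := by
          refine add_le_add le_rfl (ENNReal.ofReal_le_ofReal ?_)
          calc L * U.indicator 1 z ≤ L * 1 := by
                refine mul_le_mul_of_nonneg_left ?_ hL0
                exact Set.indicator_le_self' (fun _ _ => zero_le_one) z
            _ = L := mul_one L
      _ = (κ₀.toNNReal : ℝ≥0∞) * ENNReal.ofReal (Real.exp (θ * P.rbEnergy N z)) + L.toNNReal := by
          rw [ENNReal.ofReal_mul hκ0.le]; rfl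
  · obtain ⟨t_C, ht_C⟩ := hsmall _ (P.isCompact_setOf_exp_rbEnergy_le hUc hVc hcpt hθ0 R)
    refine ⟨t_C, fun t ht => ?_⟩
    obtain ⟨ν, hν0, hν⟩ := ht_C t ht
    exact ⟨ν, hν0, fun z hz => hν z hz⟩

include hUc hVc hγ hL hR hFeller h26 h39 hcpt hsmall in
/-- **Existence of an invariant probability measure integrating every `e^{θG}`**
(Krylov–Bogoliubov, from (26), (39), the Feller property and compact sublevel sets of `G`; RBT:
"we have an invariant measure `μ`"). [cite: ReyBelletThomas2002, Thm 2.1 (proof, §5)] -/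
theorem exists_isInvariant_of_inputs :
    ∃ μ : Measure (RBPhaseSpace N), IsProbabilityMeasure μ ∧ S.IsInvariant μ ∧
      ∀ θ : ℝ, 0 < θ → θ < 1 / max T_L T_R →
        Integrable (fun z => Real.exp (θ * P.rbEnergy N z)) μ := by
  have hTm : 0 < 1 / max T_L T_R := by positivity
  let ι := {θ : ℝ // 0 < θ ∧ θ < 1 / max T_L T_R}
  let V : ι → RBPhaseSpace N → ℝ≥0 := fun θ x => (Real.exp (θ.1 * P.rbEnergy N x)).toNNReal
  have hVapply : ∀ (θ : ι) (x : RBPhaseSpace N),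
      (V θ x : ℝ≥0∞) = ENNReal.ofReal (Real.exp (θ.1 * P.rbEnergy N x)) := fun θ x => rfl
  have hV : ∀ θ : ι, Continuous (V θ) := fun θ =>
    continuous_real_toNNReal.comp (P.continuous_exp_mul_rbEnergy hUc hVc N θ.1)
  have hCT : 0 ≤ P.γ * (T_L + T_R) := by positivity
  have hlyap : ∀ θ : ι, ∃ (tstar : ℝ≥0) (a b c : ℝ≥0∞), 0 < tstar ∧ a < 1 ∧ b ≠ ⊤ ∧ c ≠ ⊤ ∧
      (∀ x, ∫⁻ y, V θ y ∂(S.kernel tstar x) ≤ a * V θ x + b) ∧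
      (∀ r : ℝ≥0, r < tstar → ∀ x, ∫⁻ y, V θ y ∂(S.kernel r x) ≤ c * V θ x) := by
    intro θ
    obtain ⟨t₁, a, b₀, ht₁, ha1, hdrift, -⟩ :=
      harris_inputs_of_h39 hUc hVc S hcpt h39 hsmall θ.2.1 θ.2.2
    refine ⟨t₁, a, b₀, ENNReal.ofReal (Real.exp (P.γ * (T_L + T_R) * θ.1 * t₁)), ht₁,
      by exact_mod_cast ha1, ENNReal.coe_ne_top, ENNReal.ofReal_ne_top, hdrift, fun r hr x => ?_⟩
    refine (h26 θ.1 θ.2.1 θ.2.2 r x).trans ?_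
    rw [hVapply, ← ENNReal.ofReal_mul (by positivity)]
    refine ENNReal.ofReal_le_ofReal (mul_le_mul_of_nonneg_right ?_ (by positivity))
    refine Real.exp_le_exp.2 (mul_le_mul_of_nonneg_left (by exact_mod_cast hr.le) ?_)
    have := θ.2.1; positivity
  let θ₀ : ι := ⟨1 / max T_L T_R / 2, by positivity, half_lt_self hTm⟩
  have hcpt' : ∀ R : ℝ≥0, IsCompact {x | V θ₀ x ≤ R} := fun R =>
    P.isCompact_setOf_exp_rbEnergy_le hUc hVc hcpt (θ := θ₀.1) (by positivity) R
  obtain ⟨μ, hμ, hinv, hfin⟩ := MarkovSemigroup.exists_invariant_of_lyapunov S.kernel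
    S.kernel_zero S.kernel_add S.measurable_kernel hFeller V hV hlyap θ₀ hcpt' 0
  refine ⟨μ, hμ, hinv, fun θ h0 h1 => ?_⟩
  refine ⟨(P.continuous_exp_mul_rbEnergy hUc hVc N θ).aestronglyMeasurable, ?_⟩
  have hlt := hfin ⟨θ, h0, h1⟩
  simp only [hVapply] at hlt
  show ∫⁻ x, ‖Real.exp (θ * P.rbEnergy N x)‖ₑ ∂μ < ⊤
  simpa only [Real.enorm_eq_ofReal (Real.exp_nonneg _)] using hlt

include hUc hVc hL h39 hcpt hsmall in
/-- **Uniqueness of the invariant probability measure** (Harris on a skeleton; RBT: "this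
invariant measure is unique"). [cite: ReyBelletThomas2002, Thm 2.1 (proof, §5)] -/
theorem isInvariant_unique_of_inputs {μ₁ μ₂ : Measure (RBPhaseSpace N)} [IsProbabilityMeasure μ₁]
    [IsProbabilityMeasure μ₂] (h₁ : S.IsInvariant μ₁) (h₂ : S.IsInvariant μ₂) : μ₁ = μ₂ := by
  have hTm : 0 < 1 / max T_L T_R := by positivity
  obtain ⟨t₁, a, b₀, ht₁, ha1, hdrift, hminor⟩ :=
    harris_inputs_of_h39 hUc hVc S hcpt h39 hsmall (θ := 1 / max T_L T_R / 2) (by positivity)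
      (half_lt_self hTm)
  have hV : Measurable fun x : RBPhaseSpace N =>
      (Real.exp (1 / max T_L T_R / 2 * P.rbEnergy N x)).toNNReal :=
    (continuous_real_toNNReal.comp (P.continuous_exp_mul_rbEnergy hUc hVc N _)).measurable
  exact MarkovSemigroup.invariant_unique_of_drift_of_minorization S.kernel S.kernel_zero
    S.kernel_add hV ht₁ ha1 hdrift hminor h₁ h₂

include h26 in
/-- `e^{θG}` is integrable under every transition probability (from (26)). [cite: ReyBelletThomas2002, Lemma 3.5] -/
theorem integrable_exp_kernel_of_h26 (hUc : Continuous P.U) (hVc : Continuous P.V) {θ : ℝ}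
    (hθ0 : 0 < θ) (hθ1 : θ < 1 / max T_L T_R) (t : ℝ≥0) (x : RBPhaseSpace N) :
    Integrable (fun y => Real.exp (θ * P.rbEnergy N y)) (S.kernel t x) := by
  refine ⟨(P.continuous_exp_mul_rbEnergy hUc hVc N θ).aestronglyMeasurable, ?_⟩
  show ∫⁻ y, ‖Real.exp (θ * P.rbEnergy N y)‖ₑ ∂(S.kernel t x) < ⊤
  simp only [Real.enorm_eq_ofReal (Real.exp_nonneg _)]
  exact (h26 θ hθ0 hθ1 t x).trans_lt ENNReal.ofReal_lt_top

include hUc hVc hγ hL hR h26 h39 hcpt hsmall in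
/-- **The exponential convergence (16)** at level `θ`: for an invariant probability measure `μ`
there are `r > 1`, `R ≥ 0` with `|T^t f(x) - μ(f)| ≤ R r^{-t} e^{θG(x)}` for all `x`, `t ≥ 0` and
all measurable `f` with `|f| ≤ e^{θG}` (Harris on the skeleton + (26) for the intermediate times,
RBT (49); the constant `1 + e^{θG}` of the abstract theorem is absorbed using a lower bound of
`G`, which exists since `G` is continuous with compact sublevel sets).
[cite: ReyBelletThomas2002, Thm 2.1 (proof, §5)] -/
theorem exp_convergence_of_inputs {θ : ℝ} (hθ0 : 0 < θ) (hθ1 : θ < 1 / max T_L T_R)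
    (μ : Measure (RBPhaseSpace N)) [IsProbabilityMeasure μ] (hμ : S.IsInvariant μ) :
    ∃ r R : ℝ, 1 < r ∧ 0 ≤ R ∧
      ∀ (x : RBPhaseSpace N) (t : ℝ≥0) (f : RBPhaseSpace N → ℝ), Measurable f →
        (∀ y, |f y| ≤ Real.exp (θ * P.rbEnergy N y)) →
        |S.act t f x - ∫ y, f y ∂μ| ≤ R * r ^ (-(t : ℝ)) * Real.exp (θ * P.rbEnergy N x) := by
  obtain ⟨t₁, a, b₀, ht₁, ha1, hdrift, hminor⟩ :=
    harris_inputs_of_h39 hUc hVc S hcpt h39 hsmall hθ0 hθ1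
  set V : RBPhaseSpace N → ℝ≥0 := fun x => (Real.exp (θ * P.rbEnergy N x)).toNNReal with hVdef
  have hVc' : Continuous V := continuous_real_toNNReal.comp (P.continuous_exp_mul_rbEnergy hUc hVc N θ)
  have hV : Measurable V := hVc'.measurable
  have hVreal : ∀ z, (V z : ℝ) = Real.exp (θ * P.rbEnergy N z) := fun z =>
    Real.coe_toNNReal _ (Real.exp_pos _).le
  have hVcoe : ∀ z, (V z : ℝ≥0∞) = ENNReal.ofReal (Real.exp (θ * P.rbEnergy N z)) := fun z => rfl
  set Cstar : ℝ := P.γ * (T_L + T_R) * θ with hCstar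
  have hCstar0 : 0 ≤ Cstar := by rw [hCstar]; positivity
  have hflow : ∀ (s : ℝ≥0) (x : RBPhaseSpace N),
      ∫⁻ y, (V y : ℝ≥0∞) ∂(S.kernel s x) ≤ ENNReal.ofReal (Real.exp (Cstar * s)) * V x := by
    intro s x
    refine (h26 θ hθ0 hθ1 s x).trans (le_of_eq ?_)
    rw [ENNReal.ofReal_mul (Real.exp_pos _).le, hVcoe]
  obtain ⟨C, c, hC, hc, hconv⟩ := MarkovSemigroup.exp_convergence_of_drift_of_minorization S.kernel
    S.kernel_zero S.kernel_add hV ht₁ ha1 hdrift hminor hCstar0 hflow μ hμ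
  obtain ⟨m₀, hm₀⟩ := P.exists_le_rbEnergy hUc hVc hcpt
  -- `1 + e^{θG} ≤ (e^{-θ m₀} + 1) e^{θG}`
  set K₀ : ℝ := Real.exp (-(θ * m₀)) + 1 with hK₀
  have hK : ∀ x : RBPhaseSpace N, 1 + Real.exp (θ * P.rbEnergy N x) ≤
      K₀ * Real.exp (θ * P.rbEnergy N x) := by
    intro x
    have h1 : (1 : ℝ) ≤ Real.exp (-(θ * m₀)) * Real.exp (θ * P.rbEnergy N x) := by
      rw [← Real.exp_add]
      exact Real.one_le_exp (by nlinarith [hm₀ x])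
    rw [hK₀]
    nlinarith [Real.exp_pos (θ * P.rbEnergy N x)]
  refine ⟨Real.exp c, C * K₀, Real.one_lt_exp_iff.2 hc, by positivity, fun x t f hf hfV => ?_⟩
  have hfV' : ∀ y, |f y| ≤ V y := fun y => by rw [hVreal]; exact hfV y
  have h := hconv x t f hf hfV'
  rw [MarkovSemigroupFor.act_apply]
  refine h.trans ?_
  have hrpow : Real.exp c ^ (-(t : ℝ)) = Real.exp (-c * t) := by
    rw [Real.rpow_def_of_pos (Real.exp_pos c), Real.log_exp]; ring_nf
  rw [hrpow, hVreal]
  calc C * (1 + Real.exp (θ * P.rbEnergy N x)) * Real.exp (-c * t)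
      ≤ C * (K₀ * Real.exp (θ * P.rbEnergy N x)) * Real.exp (-c * t) := by
        gcongr
        exact hK x
    _ = C * K₀ * Real.exp (-c * t) * Real.exp (θ * P.rbEnergy N x) := by ring

omit S in
/-- Rescaling the convergence bound: from `|f| ≤ e^{θG} ⇒ |T^t f - μf| ≤ R r^{-t} e^{θG}` to
`|f| ≤ K e^{θG} ⇒ |T^t f - μf| ≤ K R r^{-t} e^{θG}` (`K ≥ 0`; linearity of `T^t` and `μ`).
[folklore] -/
theorem act_sub_integral_le_of_abs_le_mul (S : MarkovSemigroupFor (P.rbGenerator Λ N T_L T_R))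
    {θ r R : ℝ} {μ : Measure (RBPhaseSpace N)}
    (h16 : ∀ (x : RBPhaseSpace N) (t : ℝ≥0) (f : RBPhaseSpace N → ℝ), Measurable f →
      (∀ y, |f y| ≤ Real.exp (θ * P.rbEnergy N y)) →
      |S.act t f x - ∫ y, f y ∂μ| ≤ R * r ^ (-(t : ℝ)) * Real.exp (θ * P.rbEnergy N x))
    {K : ℝ} (hK : 0 ≤ K) (x : RBPhaseSpace N) (t : ℝ≥0) {f : RBPhaseSpace N → ℝ}
    (hf : Measurable f) (hfK : ∀ y, |f y| ≤ K * Real.exp (θ * P.rbEnergy N y)) :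
    |S.act t f x - ∫ y, f y ∂μ| ≤ K * (R * r ^ (-(t : ℝ)) * Real.exp (θ * P.rbEnergy N x)) := by
  rcases hK.eq_or_lt with hK0 | hKpos
  · -- `K = 0`: `f = 0`
    have hf0 : f = fun _ => 0 := by
      funext y
      have := hfK y
      rw [← hK0, zero_mul] at this
      exact abs_nonpos_iff.1 this
    rw [hf0, MarkovSemigroupFor.act_const, integral_zero, sub_self, abs_zero, ← hK0, zero_mul]
  · have h := h16 x t (fun y => K⁻¹ * f y) (hf.const_mul _) fun y => by
      rw [abs_mul, abs_of_pos (inv_pos.2 hKpos), inv_mul_le_iff₀ hKpos]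
      exact hfK y
    rw [MarkovSemigroupFor.act_apply, integral_const_mul, integral_const_mul, ← mul_sub, abs_mul,
      abs_of_pos (inv_pos.2 hKpos), inv_mul_le_iff₀ hKpos] at h
    rw [MarkovSemigroupFor.act_apply]
    exact h

omit S in
/-- `e^{θG/2} ≤ 1 + e^{θG}`. [folklore] -/
theorem exp_half_mul_le (θ : ℝ) (y : RBPhaseSpace N) :
    Real.exp (θ / 2 * P.rbEnergy N y) ≤ 1 + Real.exp (θ * P.rbEnergy N y) := by
  rcases le_total 0 (θ * P.rbEnergy N y) with h | h
  · have : Real.exp (θ / 2 * P.rbEnergy N y) ≤ Real.exp (θ * P.rbEnergy N y) :=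
      Real.exp_le_exp.2 (by nlinarith)
    linarith [this]
  · have : Real.exp (θ / 2 * P.rbEnergy N y) ≤ 1 := Real.exp_le_one_iff.2 (by nlinarith)
    linarith [Real.exp_pos (θ * P.rbEnergy N y)]

omit S in
/-- From `f² ≤ a e^{θG}`: `a ≥ 0` and `|f| ≤ √a e^{θG/2}`. [folklore] -/
theorem abs_le_sqrt_mul_exp_half {θ a : ℝ} {f : RBPhaseSpace N → ℝ}
    (hf : ∀ y, f y ^ 2 ≤ a * Real.exp (θ * P.rbEnergy N y)) :
    0 ≤ a ∧ ∀ y, |f y| ≤ Real.sqrt a * Real.exp (θ / 2 * P.rbEnergy N y) := by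
  have ha : 0 ≤ a := by
    have h := hf 0
    have he := Real.exp_pos (θ * P.rbEnergy N 0)
    nlinarith [sq_nonneg (f 0)]
  refine ⟨ha, fun y => ?_⟩
  have h := Real.abs_le_sqrt (hf y)
  rw [Real.sqrt_mul ha, ← Real.exp_half,
    show θ * P.rbEnergy N y / 2 = θ / 2 * P.rbEnergy N y by ring] at h
  exact h

include hUc hVc hγ hL hR h26 h39 hcpt hsmall in
/-- **Exponential decay of correlations in the stationary state** (RBT Thm 2.1, last clause;
proof of Cor. 5.2: the convergence (16) at level `θ/2` applied to `f` with `|f| ≤ ‖f²‖_θ^{1/2}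
e^{θG/2}`, integrated against `|g| ≤ ‖g²‖_θ^{1/2} e^{θG/2}` and `μ`, using `μ(e^{θG}) < ∞`): for an
invariant probability measure `μ` integrating every `e^{θ'G}` there are `r > 1`, `R ≥ 0` with
`|∫ g T^t f dμ - μ(f) μ(g)| ≤ R r^{-t} √a √b` whenever `f² ≤ a e^{θG}`, `g² ≤ b e^{θG}`.
[cite: ReyBelletThomas2002, Thm 2.1 and Cor 5.2] -/
theorem correlation_decay_of_inputs {θ : ℝ} (hθ0 : 0 < θ) (hθ1 : θ < 1 / max T_L T_R)
    (μ : Measure (RBPhaseSpace N)) [IsProbabilityMeasure μ] (hμ : S.IsInvariant μ)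
    (hμint : Integrable (fun z => Real.exp (θ * P.rbEnergy N z)) μ) :
    ∃ r R : ℝ, 1 < r ∧ 0 ≤ R ∧
      ∀ (t : ℝ≥0) (f g : RBPhaseSpace N → ℝ) (a b : ℝ), Measurable f → Measurable g →
        (∀ y, f y ^ 2 ≤ a * Real.exp (θ * P.rbEnergy N y)) →
        (∀ y, g y ^ 2 ≤ b * Real.exp (θ * P.rbEnergy N y)) →
        |∫ y, g y * S.act t f y ∂μ - (∫ y, f y ∂μ) * ∫ y, g y ∂μ| ≤
          R * r ^ (-(t : ℝ)) * Real.sqrt a * Real.sqrt b := by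
  -- (16) at level `θ/2`
  have hθ2 : 0 < θ / 2 := by positivity
  have hθ2' : θ / 2 < 1 / max T_L T_R := by linarith
  obtain ⟨r, R, hr, hR0, h16⟩ := exp_convergence_of_inputs hUc hVc hγ hL hR hcpt S h26 h39 hsmall
    hθ2 hθ2' μ hμ
  set M : ℝ := ∫ z, Real.exp (θ * P.rbEnergy N z) ∂μ with hM
  have hM0 : 0 ≤ M := integral_nonneg fun z => (Real.exp_pos _).le
  refine ⟨r, R * M, hr, by positivity, fun t f g a b hf hg hfa hgb => ?_⟩
  obtain ⟨ha, hfa'⟩ := abs_le_sqrt_mul_exp_half hfa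
  obtain ⟨hb, hgb'⟩ := abs_le_sqrt_mul_exp_half hgb
  have hrt : 0 ≤ r ^ (-(t : ℝ)) := Real.rpow_nonneg (by linarith) _
  -- integrability bookkeeping
  have hexp2 : Integrable (fun z => Real.exp (θ / 2 * P.rbEnergy N z)) μ :=
    ((integrable_const (1 : ℝ)).add hμint).mono'
      (P.continuous_exp_mul_rbEnergy hUc hVc N (θ / 2)).aestronglyMeasurable
      (Eventually.of_forall fun z => by
        rw [Real.norm_eq_abs, abs_of_pos (Real.exp_pos _)]
        exact exp_half_mul_le θ z)
  have hfi : Integrable f μ :=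
    (hexp2.const_mul (Real.sqrt a)).mono' hf.aestronglyMeasurable
      (Eventually.of_forall fun y => by rw [Real.norm_eq_abs]; exact hfa' y)
  have hgi : Integrable g μ :=
    (hexp2.const_mul (Real.sqrt b)).mono' hg.aestronglyMeasurable
      (Eventually.of_forall fun y => by rw [Real.norm_eq_abs]; exact hgb' y)
  -- the pointwise convergence bound for `f`
  have hconv : ∀ y, |S.act t f y - ∫ w, f w ∂μ| ≤
      Real.sqrt a * (R * r ^ (-(t : ℝ)) * Real.exp (θ / 2 * P.rbEnergy N y)) := fun y =>
    act_sub_integral_le_of_abs_le_mul S h16 (Real.sqrt_nonneg a) y t hf hfa'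
  have hactm : Measurable (S.act t f) :=
    (hf.stronglyMeasurable.integral_kernel (κ := S.kernel t)).measurable
  -- `g (T^t f - μ f)` is integrable, dominated by `√a √b R r^{-t} e^{θG}`
  set D : RBPhaseSpace N → ℝ := fun y => g y * (S.act t f y - ∫ w, f w ∂μ) with hD
  have hDb : ∀ y, |D y| ≤ Real.sqrt a * Real.sqrt b * R * r ^ (-(t : ℝ)) *
      Real.exp (θ * P.rbEnergy N y) := by
    intro y
    rw [hD, abs_mul]
    have h1 := hgb' y
    have h2 := hconv y
    have hee : Real.exp (θ / 2 * P.rbEnergy N y) * Real.exp (θ / 2 * P.rbEnergy N y) =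
        Real.exp (θ * P.rbEnergy N y) := by rw [← Real.exp_add]; ring_nf
    calc |g y| * |S.act t f y - ∫ w, f w ∂μ|
        ≤ (Real.sqrt b * Real.exp (θ / 2 * P.rbEnergy N y)) *
            (Real.sqrt a * (R * r ^ (-(t : ℝ)) * Real.exp (θ / 2 * P.rbEnergy N y))) :=
          mul_le_mul h1 h2 (abs_nonneg _) (by positivity)
      _ = Real.sqrt a * Real.sqrt b * R * r ^ (-(t : ℝ)) * Real.exp (θ * P.rbEnergy N y) := by
          rw [← hee]; ring
  have hDm : Measurable D := hg.mul (hactm.sub measurable_const)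
  have hDi : Integrable D μ :=
    (hμint.const_mul (Real.sqrt a * Real.sqrt b * R * r ^ (-(t : ℝ)))).mono'
      hDm.aestronglyMeasurable (Eventually.of_forall fun y => by rw [Real.norm_eq_abs]; exact hDb y)
  -- `g T^t f = D + (μ f) g` is integrable and `∫ g T^t f - μf μg = ∫ D`
  have hsplit : (fun y => g y * S.act t f y) = fun y => D y + (∫ w, f w ∂μ) * g y := by
    funext y; rw [hD]; ring
  have hgTi : Integrable (fun y => g y * S.act t f y) μ := by
    rw [hsplit]; exact hDi.add (hgi.const_mul _)
  have hkey : ∫ y, g y * S.act t f y ∂μ - (∫ y, f y ∂μ) * ∫ y, g y ∂μ = ∫ y, D y ∂μ := by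
    rw [hsplit, integral_add hDi (hgi.const_mul _), integral_const_mul]
    ring
  rw [hkey]
  calc |∫ y, D y ∂μ| ≤ ∫ y, |D y| ∂μ := abs_integral_le_integral_abs
    _ ≤ ∫ y, Real.sqrt a * Real.sqrt b * R * r ^ (-(t : ℝ)) * Real.exp (θ * P.rbEnergy N y) ∂μ :=
        integral_mono hDi.abs (hμint.const_mul _) fun y => hDb y
    _ = R * M * r ^ (-(t : ℝ)) * Real.sqrt a * Real.sqrt b := by
        rw [integral_const_mul, hM]; ring

include hUc hVc hγ hL hR hFeller h26 h39 hcpt hsmall in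
/-- **Rey-Bellet–Thomas 2002, Theorem 2.1 — the ergodic conclusions, assembled from the analytic
inputs (26), (39) and small compact sets (§5 of the printed proof), for a given Markov semigroup
`S` with generator `L` (13).** Under the hypotheses of this section, `S` has exactly one invariant
probability measure `μ`; for every `0 < θ < (max{T_L, T_R})⁻¹`, `e^{θG}` is integrable under `μ` and
under every `P_t(x, ·)`, and there are `r > 1`, `R < ∞` with the exponential convergence (16)
`|T^t f(x) - μ(f)| ≤ R r^{-t} e^{θG(x)}` for measurable `|f| ≤ e^{θG}`, all `x`, `t ≥ 0`, and the
exponential decay of correlations `|∫ g T^t f dμ - μ(f)μ(g)| ≤ R r^{-t} ‖f²‖_θ^{1/2} ‖g²‖_θ^{1/2}`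
— literally the last block of the named fact `ReyBelletThomas2002_thm21`, for `S`. What this does
NOT provide towards the fact: the construction of `S` (the transition semigroup of (RBT-SDE)), the
smooth transition densities, the smooth positive density of `μ`, and the three inputs themselves.
[cite: ReyBelletThomas2002, Thm 2.1 (proof, §5)] -/
theorem ReyBelletThomas2002_thm21_ergodic_of_inputs :
    ∃ μ : Measure (RBPhaseSpace N), IsProbabilityMeasure μ ∧ S.IsInvariant μ ∧
      (∀ ν : Measure (RBPhaseSpace N), IsProbabilityMeasure ν → S.IsInvariant ν → ν = μ) ∧
      ∀ θ : ℝ, 0 < θ → θ < 1 / max T_L T_R →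
        Integrable (fun y => Real.exp (θ * P.rbEnergy N y)) μ ∧
        (∀ (t : ℝ≥0) (x : RBPhaseSpace N),
          Integrable (fun y => Real.exp (θ * P.rbEnergy N y)) (S.kernel t x)) ∧
        ∃ r R : ℝ, 1 < r ∧ 0 ≤ R ∧
          (∀ (x : RBPhaseSpace N) (t : ℝ≥0) (f : RBPhaseSpace N → ℝ), Measurable f →
            (∀ y, |f y| ≤ Real.exp (θ * P.rbEnergy N y)) →
            |S.act t f x - ∫ y, f y ∂μ| ≤
              R * r ^ (-(t : ℝ)) * Real.exp (θ * P.rbEnergy N x)) ∧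
          (∀ (t : ℝ≥0) (f g : RBPhaseSpace N → ℝ) (a b : ℝ), 0 < (t : ℝ) →
            Measurable f → Measurable g →
            (∀ y, f y ^ 2 ≤ a * Real.exp (θ * P.rbEnergy N y)) →
            (∀ y, g y ^ 2 ≤ b * Real.exp (θ * P.rbEnergy N y)) →
            |∫ y, g y * S.act t f y ∂μ - (∫ y, f y ∂μ) * ∫ y, g y ∂μ| ≤
              R * r ^ (-(t : ℝ)) * Real.sqrt a * Real.sqrt b) := by
  obtain ⟨μ, hμ, hinv, hint⟩ :=
    exists_isInvariant_of_inputs hUc hVc hγ hL hR hcpt S hFeller h26 h39 hsmall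
  refine ⟨μ, hμ, hinv, fun ν hν hνinv => ?_, fun θ hθ0 hθ1 => ?_⟩
  · exact isInvariant_unique_of_inputs hUc hVc hL hcpt S h39 hsmall hνinv hinv
  refine ⟨hint θ hθ0 hθ1, fun t x => integrable_exp_kernel_of_h26 S h26 hUc hVc hθ0 hθ1 t x, ?_⟩
  obtain ⟨r₁, R₁, hr₁, hR₁, h16⟩ :=
    exp_convergence_of_inputs hUc hVc hγ hL hR hcpt S h26 h39 hsmall hθ0 hθ1 μ hinv
  obtain ⟨r₂, R₂, hr₂, hR₂, hcorr⟩ :=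
    correlation_decay_of_inputs hUc hVc hγ hL hR hcpt S h26 h39 hsmall hθ0 hθ1 μ hinv
      (hint θ hθ0 hθ1)
  -- common constants `r = min r₁ r₂`, `R = max R₁ R₂`
  refine ⟨min r₁ r₂, max R₁ R₂, lt_min hr₁ hr₂, le_max_of_le_left hR₁, ?_, ?_⟩
  · intro x t f hf hfb
    refine (h16 x t f hf hfb).trans ?_
    have h1 : r₁ ^ (-(t : ℝ)) ≤ (min r₁ r₂) ^ (-(t : ℝ)) :=
      Real.rpow_le_rpow_of_nonpos (by positivity) (min_le_left _ _) (by simp)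
    have h2 : 0 ≤ (min r₁ r₂) ^ (-(t : ℝ)) := Real.rpow_nonneg (by positivity) _
    gcongr
    exact le_max_left _ _
  · intro t f g a b _ hf hg hfa hgb
    refine (hcorr t f g a b hf hg hfa hgb).trans ?_
    have h1 : r₂ ^ (-(t : ℝ)) ≤ (min r₁ r₂) ^ (-(t : ℝ)) :=
      Real.rpow_le_rpow_of_nonpos (by positivity) (min_le_right _ _) (by simp)
    have h2 : 0 ≤ (min r₁ r₂) ^ (-(t : ℝ)) := Real.rpow_nonneg (by positivity) _
    gcongr
    exact le_max_right _ _

end Assembly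

end Literature.MathematicalPhysics.KineticTheory.HeatConduction
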